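import Literature.Analysis.FluidPDE.ForwardDSSExistenceLocalProofs
import Literature.Analysis.FluidPDE.ForwardDSSCylinderLimitProofs
import Literature.Analysis.FluidPDE.ForwardDSSCylinderLimitParts
import HarnessLib

/-!
# Forward DSS solutions: the limit fact of Bradshaw–Tsai 2019, §4.3, as originally vendored

Analysis/FluidPDE proofs file (no new definitions) closing the gap between the accepted named
fact `bradshawTsai2019_limit_4_3` (`ForwardDSSExistence.lean`; Bradshaw–Tsai, *Discretely
self-similar solutions to the Navier–Stokes equations with data in `L²_loc` satisfying the local
energy inequality*, Analysis & PDE 12 (2019) = arXiv:1801.08060, §4.3 with §4.2) and its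
localized form `bradshawTsai2019_limit_4_3_local` (`ForwardDSSExistenceLocal.lean`), which carries
the *extra* hypothesis "the approximating pressures `π_k` are `λ`-DSS" (in print supplied by the
pressure formula (3.3) of Prop. 3.1).

**Main result** (`bradshawTsai2019_limit_4_3_of_limit_4_3_local`): the extra hypothesis costs
nothing — `bradshawTsai2019_limit_4_3_local → bradshawTsai2019_limit_4_3`. By
`IsLocalLeraySolution.exists_dss_pressure` (`ForwardDSSExistenceLocalProofs.lean`: the pressure of
a local Leray solution with `λ`-DSS velocity may be re-normalised by a function of time into a
`λ`-DSS pressure, the pair staying a local Leray solution with the same datum and velocity, at the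
cost of a factor `K(λ)` on `∫₀ᵀ∫_{B₁}|π|^{3/2}`) each approximating pressure is replaced by a
`λ`-DSS one; the uniform bound `C` becomes `max (C, K(λ) C)`; the localized fact and the proved
re-scaling argument (`IsBradshawTsai2019Solution.of_local`) conclude. Consequently
(`bradshawTsai2019_limit_4_3_of_cylinderLimit`, `bradshawTsai2019_limit_4_3_of_parts`) the
original fact follows from the DSS-free compactness statement on the unit cylinder
`bradshawTsai2019_cylinderLimit` (`ForwardDSSCylinderLimit.lean`), i.e. from its two parts
`bradshawTsai2019_cylinderCompactness` (interior compactness of suitable weak solutions) and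
`bradshawTsai2019_limitDatum` (continuity of the limit at `t = 0`)
(`ForwardDSSCylinderLimitParts.lean`), and Theorem 1.2 (`bradshawTsai2019_dss_existence`) has the
trust base `{bradshawTsai2019_lemma_4_1, bradshawTsai2019_prop_3_1,
bradshawTsai2019_cylinderCompactness, bradshawTsai2019_limitDatum}`
(`bradshawTsai2019_dss_existence_of_prop_3_1_parts`) — Lemma 4.1, Prop. 3.1 as printed, and two
classical DSS-free statements about suitable weak / local Leray solutions.

## References

* Z. Bradshaw, T.-P. Tsai, Analysis & PDE 12 (2019) 1943–1962 = arXiv:1801.08060: Thm 1.2,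
  Prop. 3.1 (p. 8) and the normalisation of the pressure in its proof (p. 9), §4.2, §4.3 (proof
  of Thm 1.2, p. 12) [BradshawTsai2019].
-/

noncomputable section

open MeasureTheory TopologicalSpace Set Function Filter Metric
open scoped ENNReal NNReal Topology

namespace Literature.Analysis.FluidPDE

/-- **The DSS hypothesis on the approximating pressures is free**: the localized limit fact
`bradshawTsai2019_limit_4_3_local` (hypotheses of `bradshawTsai2019_limit_4_3` plus "`π_k` is
`λ`-DSS") implies the fact as originally vendored. Each pressure `π_k` of the `λ`-DSS local Leray
solution `(v_k, π_k)` is replaced by the `λ`-DSS pressure `π_k'` of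
`IsLocalLeraySolution.exists_dss_pressure` (same datum, same velocity — hence the same energy and
gradient bounds —, `∫₀ᵀ∫_{B₁}|π_k'|^{3/2} ≤ K(λ) C`); the localized fact applies with the uniform
constant `max (C, K(λ) C)`, and the re-scaling argument `IsBradshawTsai2019Solution.of_local`
gives the global conclusion. This is the printed situation: §4.3 works with the [BT1] pressures
normalised in the proof of Prop. 3.1 (arXiv p. 9, "we can re-define `π_ε` to equal
`π_ε − π_*(t)`"). [cite: BradshawTsai2019, §4.3 (proof of Thm 1.2) with Prop 3.1 (proof, p. 9)] -/
theorem bradshawTsai2019_limit_4_3_of_limit_4_3_local (h : bradshawTsai2019_limit_4_3_local) :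
    bradshawTsai2019_limit_4_3 := by
  intro c hc v₀ hm₀ hL2 hdiv hdss₀ w₀ v π T C hw hwdiv hwdss hconv hLL hvdss hT hE hG hP
  obtain ⟨K, hK, hKsol⟩ := IsLocalLeraySolution.exists_dss_pressure hc
  have hex : ∀ k, ∃ π' : ℝ → EuclideanSpace ℝ (Fin 3) → ℝ, IsLocalLeraySolution 1 (w₀ k) (v k) π' ∧
      nsRescalePressure c π' = π' ∧
      ∫⁻ z in Ioo 0 T ×ˢ ball (0 : EuclideanSpace ℝ (Fin 3)) 1, ‖π' z.1 z.2‖ₑ ^ (3 / 2 : ℝ) ≤ K * C := by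
    intro k
    obtain ⟨π', h1, h2, h3⟩ := hKsol (hLL k) (hvdss k)
    exact ⟨π', h1, h2, (h3 T hT).trans (mul_le_mul' le_rfl (hP k))⟩
  choose π' hπ'LL hπ'dss hπ'P using hex
  have hKC : K * C ≠ ⊤ := ENNReal.mul_ne_top hK.ne ENNReal.coe_ne_top
  have hC1 : ((C : ℝ≥0) : ℝ≥0∞) ≤ (max C (K * C).toNNReal : ℝ≥0) :=
    ENNReal.coe_le_coe.2 (le_max_left _ _)
  have hC2 : K * C ≤ (max C (K * C).toNNReal : ℝ≥0) := by
    rw [← ENNReal.coe_toNNReal hKC]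
    exact ENNReal.coe_le_coe.2 (le_max_right _ _)
  obtain ⟨u, p, hloc⟩ := h hc hm₀ hL2 hdiv hdss₀ (C := max C (K * C).toNNReal) hw hwdiv hwdss
    hconv hπ'LL hvdss hπ'dss hT
    (fun k => by
      filter_upwards [hE k] with t ht
      exact ht.trans hC1)
    (fun k => (hG k).imp fun G hG' => ⟨hG'.1, hG'.2.trans hC1⟩)
    (fun k => (hπ'P k).trans hC2)
  exact ⟨u, p, IsBradshawTsai2019Solution.of_local hc hT hm₀ hdss₀ hloc⟩

/-- **The limit fact as originally vendored follows from the DSS-free compactness statement on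
the unit cylinder**: `bradshawTsai2019_cylinderLimit → bradshawTsai2019_limit_4_3`
(`bradshawTsai2019_limit_4_3_local_of_cylinderLimit`, then
`bradshawTsai2019_limit_4_3_of_limit_4_3_local`). [cite: BradshawTsai2019, §4.3 (proof of Thm 1.2) with §4.2] -/
theorem bradshawTsai2019_limit_4_3_of_cylinderLimit (h : bradshawTsai2019_cylinderLimit) :
    bradshawTsai2019_limit_4_3 :=
  bradshawTsai2019_limit_4_3_of_limit_4_3_local
    (bradshawTsai2019_limit_4_3_local_of_cylinderLimit h)

/-- **The limit fact as originally vendored from its two DSS-free parts**: interior compactness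
of suitable weak solutions on the unit cylinder (`bradshawTsai2019_cylinderCompactness`) and the
continuity of the limit at `t = 0` (`bradshawTsai2019_limitDatum`) imply
`bradshawTsai2019_limit_4_3` (`bradshawTsai2019_cylinderLimit_of_parts`). [cite: BradshawTsai2019, §4.3 (proof of Thm 1.2) with §4.2] -/
theorem bradshawTsai2019_limit_4_3_of_parts (hC : bradshawTsai2019_cylinderCompactness)
    (hD : bradshawTsai2019_limitDatum) : bradshawTsai2019_limit_4_3 :=
  bradshawTsai2019_limit_4_3_of_cylinderLimit (bradshawTsai2019_cylinderLimit_of_parts hC hD)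

/-- **Theorem 1.2 of Bradshaw–Tsai 2019 from Lemma 4.1, Prop. 3.1 (as printed) and the DSS-free
compactness statement on the unit cylinder** (`bradshawTsai2019_dss_existence_of_parts` with
`bradshawTsai2019_limit_4_3_of_cylinderLimit`). [cite: BradshawTsai2019, Thm 1.2 (proof, §4.3)] -/
theorem bradshawTsai2019_dss_existence_of_prop_3_1_cylinderLimit
    (h41 : bradshawTsai2019_lemma_4_1) (h31 : bradshawTsai2019_prop_3_1)
    (h : bradshawTsai2019_cylinderLimit) : bradshawTsai2019_dss_existence :=
  bradshawTsai2019_dss_existence_of_parts h41 h31 (bradshawTsai2019_limit_4_3_of_cylinderLimit h)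

/-- **Theorem 1.2 of Bradshaw–Tsai 2019 from Lemma 4.1, Prop. 3.1 (as printed), interior
compactness of suitable weak solutions and the continuity of the limit at `t = 0`**: the trust
base of `bradshawTsai2019_dss_existence` in the tree is `{bradshawTsai2019_lemma_4_1,
bradshawTsai2019_prop_3_1, bradshawTsai2019_cylinderCompactness, bradshawTsai2019_limitDatum}`;
everything self-similar in §4.2–§4.3, including the normalisation of the pressures, is proved. [cite: BradshawTsai2019, Thm 1.2 (proof, §4.3)] -/
theorem bradshawTsai2019_dss_existence_of_prop_3_1_parts (h41 : bradshawTsai2019_lemma_4_1)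
    (h31 : bradshawTsai2019_prop_3_1) (hC : bradshawTsai2019_cylinderCompactness)
    (hD : bradshawTsai2019_limitDatum) : bradshawTsai2019_dss_existence :=
  bradshawTsai2019_dss_existence_of_parts h41 h31 (bradshawTsai2019_limit_4_3_of_parts hC hD)

/-- The historical `chae_wolf_dss_existence` from the same trust base. [cite: BradshawTsai2019, Thm 1.2] -/
theorem chae_wolf_dss_existence_of_prop_3_1_parts (h41 : bradshawTsai2019_lemma_4_1)
    (h31 : bradshawTsai2019_prop_3_1) (hC : bradshawTsai2019_cylinderCompactness)
    (hD : bradshawTsai2019_limitDatum) : chae_wolf_dss_existence :=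
  chae_wolf_dss_existence_of_bradshawTsai2019
    (bradshawTsai2019_dss_existence_of_prop_3_1_parts h41 h31 hC hD)

end Literature.Analysis.FluidPDE

end
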